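import Summits.HodgeConjecture.HodgeConjecture.Theorems.Ring2WeilCoverageCMFieldZeta5
import HarnessLib

/-!
# Non-split Weil-type components over quartic CM fields by ℓ-adic descent (generic in Deligne's
# `R = S² + pS + q`), and the instance `E = ℚ(√-(2+√2)) ⊂ ℚ(ζ₁₆)`: `[3w] ≠ [1]`, `3 ∤ w`

research route conditional on HC_CM; not a corollary; Q11.4-sentence-2 already refuted in dim ≥ 3.
Cell `pub-hodge-ring2`, seat `ring2-b03` (gen 46); kernel certificates for the Weil-type family-coverage
census `HOME/WEIL-FAMILY-COVERAGE.md` §b03.5 (operator priority5 2026-08-22T11:46:08Z), companion of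
`Theorems/Ring2WeilCoverageCMFieldZeta5.lean` (the case `R = S² + 5S + 5`, `E = ℚ(ζ₅)`; its `norm_coords` is reused), here made GENERIC:

* §1–§3 (any quadratic `R = S² + pS + q`, `p, q ∈ ℤ`, with `F = ℚ[S]/(R)` a field): on Deligne's carriers
  (`Deligne1982/WeilTypeCMDiscriminant`: `cmField R = ℚ[T]/(R(T²)) = E`, `realField R = F`,
  `cmNormResidueGroup R = Fˣ ⧸ Nm_{E/F}(Eˣ)`), a norm `z z̄`, `z = a + bη`, is `a² - σb²` (`σ = [S] = η²`),
  and in the coordinates `a = a₀ + a₁σ`, `b = b₀ + b₁σ` the equation `a² - σb² = ℓw` is the pair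
  `a₀² - q a₁² + 2q b₀b₁ - pq b₁² = ℓw`, `2a₀a₁ - p a₁² - b₀² + 2p b₀b₁ - (p² - q) b₁² = 0` over `ℚ`;
  if these two forms are ANISOTROPIC mod a prime `ℓ` (hypothesis `haniso`, decided per instance — it says
  that `ℓ` is inert in `F` and in `E/F`) and `ℓ ∤ w`, clearing denominators and infinite descent show there
  is no solution: **`[ℓw]` is not the split class `[(-1)^2] = [1]`** (`mk_prime_mul_ne_splitDiscriminantClassCM`).
* §4 instance `p = 4`, `q = 2` (`η² = -(2+√2)`, `E = ℚ(√-(2+√2))` the CM field inside `ℚ(ζ₁₆)`,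
  `F = ℚ(√2)`; both carrier polynomials Eisenstein at `2`), `ℓ = 3` (an 81-case `decide` over `𝔽₉`):
  the components `W8.E.δ`, `δ ∈ {[3], [6], [12], [15], [21], [24], [30], [33], [39], …}` of the census
  (abelian eightfolds of Weil type `(2,2;2,2)` relative to `E`) are NON-SPLIT (Deligne Cor. 4.2: no
  `E`-Lagrangian member).

No named fact, no definition, no `sorry`; nothing about the Hodge conjecture is asserted.
References: [Deligne1982HodgeCycles] §4 p. 30 (1), Cor. 4.2, Lemma 4.6; [Landherr1936HermitianForms]. -/

noncomputable section

set_option linter.dupNamespace false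

open Polynomial

namespace Summit.HodgeConjecture.HodgeConjecture.Ring2.WeilCoverageCM

open Literature.AlgebraicGeometry.Deligne1982
open Literature.AlgebraicGeometry.HodgeTheory (splitDiscriminantClassCM)

/-! ### §1 The arithmetic core, generic: descent from anisotropy mod `ℓ` -/

section Descent

variable (p q : ℤ) (ℓ : ℕ) [hℓ : Fact ℓ.Prime]

/-- **Integer descent from anisotropy mod `ℓ`**: if the two coordinate forms vanish mod `ℓ` only at the
origin, then `X = ℓwM²`, `Y = 0` with `ℓ ∤ w` force `M = 0`. [folklore] -/
theorem descent_of_aniso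
    (haniso : ∀ a b c d : ZMod ℓ,
      a ^ 2 - (q : ZMod ℓ) * b ^ 2 + 2 * (q : ZMod ℓ) * c * d - (p : ZMod ℓ) * (q : ZMod ℓ) * d ^ 2 = 0 →
      2 * a * b - (p : ZMod ℓ) * b ^ 2 - c ^ 2 + 2 * (p : ZMod ℓ) * c * d
          - ((p : ZMod ℓ) ^ 2 - (q : ZMod ℓ)) * d ^ 2 = 0 →
        a = 0 ∧ b = 0 ∧ c = 0 ∧ d = 0)
    (w : ℤ) (hw : ¬ (ℓ : ℤ) ∣ w) :
    ∀ (n : ℕ) (A B Cc D M : ℤ), M.natAbs ≤ n →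
      A ^ 2 - q * B ^ 2 + 2 * q * Cc * D - p * q * D ^ 2 = ℓ * w * M ^ 2 →
      2 * A * B - p * B ^ 2 - Cc ^ 2 + 2 * p * Cc * D - (p ^ 2 - q) * D ^ 2 = 0 → M = 0 := by
  have hℓp : Prime (ℓ : ℤ) := Nat.prime_iff_prime_int.1 hℓ.out
  have hℓ0 : (ℓ : ℤ) ≠ 0 := hℓp.ne_zero
  have hℓ2 : 2 ≤ ℓ := hℓ.out.two_le
  intro n
  induction n with
  | zero => intro A B Cc D M h1 _ _; omega
  | succ n ih =>
    intro A B Cc D M h1 hX hY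
    have h3 : ((A : ZMod ℓ)) = 0 ∧ ((B : ZMod ℓ)) = 0 ∧ ((Cc : ZMod ℓ)) = 0 ∧ ((D : ZMod ℓ)) = 0 := by
      apply haniso
      · have := congrArg (Int.cast : ℤ → ZMod ℓ) hX
        push_cast at this
        rw [this, ZMod.natCast_self]
        ring
      · have := congrArg (Int.cast : ℤ → ZMod ℓ) hY
        push_cast at this
        exact this
    obtain ⟨hA, hB, hC, hD⟩ := h3
    rw [ZMod.intCast_zmod_eq_zero_iff_dvd] at hA hB hC hD
    obtain ⟨⟨A', rfl⟩, ⟨B', rfl⟩, ⟨C', rfl⟩, ⟨D', rfl⟩⟩ := And.intro hA (And.intro hB (And.intro hC hD))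
    have hX' : (ℓ : ℤ) * (A' ^ 2 - q * B' ^ 2 + 2 * q * C' * D' - p * q * D' ^ 2) = w * M ^ 2 := by
      have h9 : (ℓ : ℤ) * ((ℓ : ℤ) * (A' ^ 2 - q * B' ^ 2 + 2 * q * C' * D' - p * q * D' ^ 2)) =
          (ℓ : ℤ) * (w * M ^ 2) := by
        rw [← mul_assoc (ℓ : ℤ) w, ← hX]; ring
      exact mul_left_cancel₀ hℓ0 h9
    have hMℓ : (ℓ : ℤ) ∣ M := by
      have h3 : (ℓ : ℤ) ∣ w * M ^ 2 := ⟨_, hX'.symm⟩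
      rcases hℓp.dvd_or_dvd h3 with h | h
      · exact absurd h hw
      · exact hℓp.dvd_of_dvd_pow h
    obtain ⟨M', rfl⟩ := hMℓ
    have hX'' : A' ^ 2 - q * B' ^ 2 + 2 * q * C' * D' - p * q * D' ^ 2 = ℓ * w * M' ^ 2 := by
      have : (ℓ : ℤ) * (A' ^ 2 - q * B' ^ 2 + 2 * q * C' * D' - p * q * D' ^ 2) = ℓ * (ℓ * w * M' ^ 2) := by
        rw [hX']; ring
      exact mul_left_cancel₀ hℓ0 this
    have hY'' : 2 * A' * B' - p * B' ^ 2 - C' ^ 2 + 2 * p * C' * D' - (p ^ 2 - q) * D' ^ 2 = 0 := by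
      have : ((ℓ : ℤ) * ℓ) * (2 * A' * B' - p * B' ^ 2 - C' ^ 2 + 2 * p * C' * D' - (p ^ 2 - q) * D' ^ 2) = 0 := by
        rw [← hY]; ring
      exact (mul_eq_zero.1 this).resolve_left (mul_ne_zero hℓ0 hℓ0)
    have hbound : M'.natAbs ≤ n := by
      have e : ((ℓ : ℤ) * M').natAbs = ℓ * M'.natAbs := by
        rw [Int.natAbs_mul, Int.natAbs_natCast]
      rw [e] at h1
      rcases Nat.lt_or_ge n M'.natAbs with hc | hc
      · nlinarith
      · exact hc
    have hM' : M' = 0 := ih A' B' C' D' M' hbound hX'' hY''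
    rw [hM', mul_zero]

/-- **No rational solutions from anisotropy mod `ℓ`** (clear denominators, `descent_of_aniso`). [folklore] -/
theorem rat_no_solution_of_aniso
    (haniso : ∀ a b c d : ZMod ℓ,
      a ^ 2 - (q : ZMod ℓ) * b ^ 2 + 2 * (q : ZMod ℓ) * c * d - (p : ZMod ℓ) * (q : ZMod ℓ) * d ^ 2 = 0 →
      2 * a * b - (p : ZMod ℓ) * b ^ 2 - c ^ 2 + 2 * (p : ZMod ℓ) * c * d
          - ((p : ZMod ℓ) ^ 2 - (q : ZMod ℓ)) * d ^ 2 = 0 →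
        a = 0 ∧ b = 0 ∧ c = 0 ∧ d = 0)
    (w : ℤ) (hw : ¬ (ℓ : ℤ) ∣ w) (a₀ a₁ b₀ b₁ : ℚ)
    (hX : a₀ ^ 2 - q * a₁ ^ 2 + 2 * q * b₀ * b₁ - p * q * b₁ ^ 2 = ℓ * w)
    (hY : 2 * a₀ * a₁ - p * a₁ ^ 2 - b₀ ^ 2 + 2 * p * b₀ * b₁ - (p ^ 2 - q) * b₁ ^ 2 = 0) : False := by
  set m : ℕ := a₀.den * a₁.den * b₀.den * b₁.den with hm
  have hm0 : (m : ℤ) ≠ 0 := by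
    have : 0 < m := by
      rw [hm]; exact Nat.mul_pos (Nat.mul_pos (Nat.mul_pos a₀.den_pos a₁.den_pos) b₀.den_pos) b₁.den_pos
    exact_mod_cast this.ne'
  have key : ∀ (r : ℚ) (k : ℕ), ((r.num * k : ℤ) : ℚ) = r * (r.den * k : ℕ) := by
    intro r k
    push_cast
    rw [← mul_assoc, Rat.mul_den_eq_num]
  obtain ⟨A, hA⟩ : ∃ A : ℤ, (A : ℚ) = a₀ * m :=
    ⟨a₀.num * (a₁.den * b₀.den * b₁.den : ℕ), by rw [key, hm]; push_cast; ring⟩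
  obtain ⟨B, hB⟩ : ∃ B : ℤ, (B : ℚ) = a₁ * m :=
    ⟨a₁.num * (a₀.den * b₀.den * b₁.den : ℕ), by rw [key, hm]; push_cast; ring⟩
  obtain ⟨Cc, hC⟩ : ∃ Cc : ℤ, (Cc : ℚ) = b₀ * m :=
    ⟨b₀.num * (a₀.den * a₁.den * b₁.den : ℕ), by rw [key, hm]; push_cast; ring⟩
  obtain ⟨D, hD⟩ : ∃ D : ℤ, (D : ℚ) = b₁ * m :=
    ⟨b₁.num * (a₀.den * a₁.den * b₀.den : ℕ), by rw [key, hm]; push_cast; ring⟩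
  have hXZ : A ^ 2 - q * B ^ 2 + 2 * q * Cc * D - p * q * D ^ 2 = ℓ * w * (m : ℤ) ^ 2 := by
    have h : (A : ℚ) ^ 2 - q * (B : ℚ) ^ 2 + 2 * q * (Cc : ℚ) * D - p * q * (D : ℚ) ^ 2 =
        ℓ * w * ((m : ℤ) : ℚ) ^ 2 := by
      rw [hA, hB, hC, hD]; push_cast; linear_combination ((m : ℚ)) ^ 2 * hX
    exact_mod_cast h
  have hYZ : 2 * A * B - p * B ^ 2 - Cc ^ 2 + 2 * p * Cc * D - (p ^ 2 - q) * D ^ 2 = 0 := by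
    have h : 2 * (A : ℚ) * B - p * (B : ℚ) ^ 2 - (Cc : ℚ) ^ 2 + 2 * p * (Cc : ℚ) * D
        - (p ^ 2 - q) * (D : ℚ) ^ 2 = 0 := by
      rw [hA, hB, hC, hD]; linear_combination ((m : ℚ)) ^ 2 * hY
    exact_mod_cast h
  have := descent_of_aniso p q ℓ haniso w hw (m : ℤ).natAbs A B Cc D m le_rfl hXZ hYZ
  exact hm0 this

end Descent

/-! ### §2 Coordinates on `F = ℚ[S]/(S² + pS + q) = ℚ ⊕ ℚσ` (`σ = AdjoinRoot.root`, `ι = AdjoinRoot.of`) -/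

section Coordinates

variable {p q : ℤ} {R : Polynomial ℤ} [Fact (Irreducible (realPolyQ R))]

/-- `realPolyQ (S² + pS + q) = S² + pS + q ∈ ℚ[S]`. [cite: Deligne1982HodgeCycles, §4 p. 30] -/
theorem realPolyQ_quadratic (hR : R = X ^ 2 + C p * X + C q) :
    realPolyQ R = X ^ 2 + C (p : ℚ) * X + C (q : ℚ) := by
  subst hR
  show Polynomial.map (Int.castRingHom ℚ) (X ^ 2 + C p * X + C q) = _
  rw [Polynomial.map_add, Polynomial.map_add, Polynomial.map_mul, Polynomial.map_pow, map_X, map_C, map_C,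
    eq_intCast, eq_intCast]

/-- `σ² + pσ + q = 0` in `F`. [cite: Deligne1982HodgeCycles, §4 p. 30] -/
theorem root_rel_quadratic (hR : R = X ^ 2 + C p * X + C q) :
    AdjoinRoot.root (realPolyQ R) ^ 2 + (p : ℚ) * AdjoinRoot.root (realPolyQ R) + (q : ℚ) = 0 := by
  have h : AdjoinRoot.mk (realPolyQ R) (X ^ 2 + C (p : ℚ) * X + C (q : ℚ)) = 0 := by
    rw [← realPolyQ_quadratic hR]
    exact AdjoinRoot.mk_self
  rw [map_add, map_add, map_mul, map_pow, AdjoinRoot.mk_X, AdjoinRoot.mk_C, AdjoinRoot.mk_C] at h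
  rw [← h, ← map_ratCast (AdjoinRoot.of (realPolyQ R)), ← map_ratCast (AdjoinRoot.of (realPolyQ R)),
    Rat.cast_intCast, Rat.cast_intCast]

/-- `F = ℚ ⊕ ℚσ`: every element of `F` is `ι x + ι y · σ`. [cite: Deligne1982HodgeCycles, §4 p. 30] -/
theorem exists_coords_quadratic (hR : R = X ^ 2 + C p * X + C q) (x : realField R) :
    ∃ u v : ℚ, x = AdjoinRoot.of (realPolyQ R) u + AdjoinRoot.of (realPolyQ R) v * AdjoinRoot.root (realPolyQ R) := by
  have hmonic : (realPolyQ R).Monic := by rw [realPolyQ_quadratic hR]; monicity!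
  have hdeg : (realPolyQ R).natDegree = 2 := by rw [realPolyQ_quadratic hR]; compute_degree!
  have hne1 : realPolyQ R ≠ 1 := fun h1 => by
    rw [h1, natDegree_one] at hdeg; exact absurd hdeg (by norm_num)
  induction x using AdjoinRoot.induction_on with
  | ih P =>
    have hmk : (AdjoinRoot.mk (realPolyQ R) P : realField R) =
        AdjoinRoot.mk (realPolyQ R) (P %ₘ realPolyQ R) := by
      rw [AdjoinRoot.mk_eq_mk]
      refine ⟨P /ₘ realPolyQ R, ?_⟩
      calc P - P %ₘ realPolyQ R
          = (P %ₘ realPolyQ R + realPolyQ R * (P /ₘ realPolyQ R)) - P %ₘ realPolyQ R := by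
            rw [Polynomial.modByMonic_add_div P (realPolyQ R)]
        _ = realPolyQ R * (P /ₘ realPolyQ R) := by ring
    have hrdeg : (P %ₘ realPolyQ R).natDegree ≤ 1 := by
      have := Polynomial.natDegree_modByMonic_lt P hmonic hne1; rw [hdeg] at this; omega
    refine ⟨(P %ₘ realPolyQ R).coeff 0, (P %ₘ realPolyQ R).coeff 1, ?_⟩
    rw [hmk]
    conv_lhs => rw [Polynomial.eq_X_add_C_of_natDegree_le_one hrdeg]
    rw [map_add, map_mul, AdjoinRoot.mk_C, AdjoinRoot.mk_C, AdjoinRoot.mk_X]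
    ring

/-- `{1, σ}` is `ℚ`-free: `ι u + ι v · σ = 0 ⇒ u = v = 0`. [cite: Deligne1982HodgeCycles, §4 p. 30] -/
theorem coords_eq_zero_quadratic (hR : R = X ^ 2 + C p * X + C q) {u v : ℚ}
    (h : AdjoinRoot.of (realPolyQ R) u + AdjoinRoot.of (realPolyQ R) v * AdjoinRoot.root (realPolyQ R) = 0) :
    u = 0 ∧ v = 0 := by
  have hmonic : (realPolyQ R).Monic := by rw [realPolyQ_quadratic hR]; monicity!
  have hdeg : (realPolyQ R).natDegree = 2 := by rw [realPolyQ_quadratic hR]; compute_degree!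
  have hmk : (AdjoinRoot.mk (realPolyQ R) (C u + C v * X) : realField R) = 0 := by
    rw [map_add, map_mul, AdjoinRoot.mk_C, AdjoinRoot.mk_C, AdjoinRoot.mk_X]
    exact h
  rw [AdjoinRoot.mk_eq_zero] at hmk
  by_cases h0 : C u + C v * X = 0
  · have h1 := congrArg (fun f : Polynomial ℚ => f.coeff 0) h0
    have h2 := congrArg (fun f : Polynomial ℚ => f.coeff 1) h0
    simp at h1 h2
    exact ⟨h1, h2⟩
  · refine absurd hmk (hmonic.not_dvd_of_natDegree_lt h0 ?_)
    have : (C u + C v * X).natDegree ≤ 1 := by compute_degree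
    rw [hdeg]; omega

/-- **The norm form `a² - σb²` in coordinates**: `a² - σ b² = ι X + ι Y · σ` with
`X = a₀² - q a₁² + 2q b₀b₁ - pq b₁²`, `Y = 2a₀a₁ - p a₁² - b₀² + 2p b₀b₁ - (p² - q) b₁²`.
[cite: Deligne1982HodgeCycles, §4 p. 30] -/
theorem normForm_coords (hR : R = X ^ 2 + C p * X + C q) (a₀ a₁ b₀ b₁ : ℚ) :
    (AdjoinRoot.of (realPolyQ R) a₀ + AdjoinRoot.of (realPolyQ R) a₁ * AdjoinRoot.root (realPolyQ R)) ^ 2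
      - AdjoinRoot.root (realPolyQ R) *
        (AdjoinRoot.of (realPolyQ R) b₀ + AdjoinRoot.of (realPolyQ R) b₁ * AdjoinRoot.root (realPolyQ R)) ^ 2
    = AdjoinRoot.of (realPolyQ R) (a₀ ^ 2 - q * a₁ ^ 2 + 2 * q * b₀ * b₁ - p * q * b₁ ^ 2) +
      AdjoinRoot.of (realPolyQ R) (2 * a₀ * a₁ - p * a₁ ^ 2 - b₀ ^ 2 + 2 * p * b₀ * b₁ - (p ^ 2 - q) * b₁ ^ 2) *
        AdjoinRoot.root (realPolyQ R) := by
  have hσ := root_rel_quadratic hR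
  have hp : ((p : ℚ) : realField R) = AdjoinRoot.of (realPolyQ R) p := (map_ratCast _ _).symm
  have hq : ((q : ℚ) : realField R) = AdjoinRoot.of (realPolyQ R) q := (map_ratCast _ _).symm
  rw [hp, hq] at hσ
  simp only [map_add, map_sub, map_mul, map_pow, map_ofNat]
  linear_combination (AdjoinRoot.of (realPolyQ R) a₁ ^ 2
      - 2 * AdjoinRoot.of (realPolyQ R) b₀ * AdjoinRoot.of (realPolyQ R) b₁
      + AdjoinRoot.of (realPolyQ R) p * AdjoinRoot.of (realPolyQ R) b₁ ^ 2
      - AdjoinRoot.of (realPolyQ R) b₁ ^ 2 * AdjoinRoot.root (realPolyQ R)) * hσ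

end Coordinates

/-! ### §3 The generic certificate: `[ℓw] ≠ [1]` from anisotropy mod `ℓ` -/

/-- **Non-split criterion (generic).** For `R = S² + pS + q` with both carrier polynomials irreducible
(instance arguments), a prime `ℓ` at which the two coordinate forms of the norm form are anisotropic
(`haniso` — i.e. `ℓ` inert in `F` and in `E/F`; decided per instance) and `ℓ ∤ w`: the class of `ℓw` in
`F^×/Nm_{E/F}(E^×)` is not the split class `[(-1)^2]` of `E`-rank `4` — the Weil-type component
`(E, d = 4, δ = [ℓw])` has no `E`-Lagrangian member. [cite: Deligne1982HodgeCycles, §4 p. 30 (1) and Cor. 4.2]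
[cite: Landherr1936HermitianForms] -/
theorem mk_prime_mul_ne_splitDiscriminantClassCM {p q : ℤ} {R : Polynomial ℤ}
    (hR : R = X ^ 2 + C p * X + C q) [Fact (Irreducible (realPolyQ R))] [Fact (Irreducible (cmPolyQ R))]
    (ℓ : ℕ) [Fact ℓ.Prime]
    (haniso : ∀ a b c d : ZMod ℓ,
      a ^ 2 - (q : ZMod ℓ) * b ^ 2 + 2 * (q : ZMod ℓ) * c * d - (p : ZMod ℓ) * (q : ZMod ℓ) * d ^ 2 = 0 →
      2 * a * b - (p : ZMod ℓ) * b ^ 2 - c ^ 2 + 2 * (p : ZMod ℓ) * c * d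
          - ((p : ZMod ℓ) ^ 2 - (q : ZMod ℓ)) * d ^ 2 = 0 →
        a = 0 ∧ b = 0 ∧ c = 0 ∧ d = 0)
    (w : ℤ) (hw : ¬ (ℓ : ℤ) ∣ w) (u : (realField R)ˣ)
    (hu : (u : realField R) = AdjoinRoot.of (realPolyQ R) (ℓ * w)) :
    (QuotientGroup.mk u : cmNormResidueGroup R) ≠ splitDiscriminantClassCM R 2 := by
  intro h
  rw [splitDiscriminantClassCM, neg_one_sq] at h
  obtain ⟨z, -, hz⟩ := exists_eq_ratCast_mul_norm_of_mk_eq (q := u) (u := 1) (c := 1)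
    (by rw [Units.val_one, Rat.cast_one]) h
  rw [Rat.cast_one, one_mul] at hz
  obtain ⟨a, b, rfl⟩ := exists_eq_realToCM_add_mul_cmRoot R z
  rw [norm_coords, algebraMap_realField_eq, hu] at hz
  have hF := (realToCM R).injective hz
  obtain ⟨a₀, a₁, rfl⟩ := exists_coords_quadratic hR a
  obtain ⟨b₀, b₁, rfl⟩ := exists_coords_quadratic hR b
  rw [normForm_coords hR] at hF
  -- move `ι(ℓw)` to the left: `ι(X - ℓw) + ι(Y) σ = 0`
  have key : AdjoinRoot.of (realPolyQ R) (a₀ ^ 2 - q * a₁ ^ 2 + 2 * q * b₀ * b₁ - p * q * b₁ ^ 2 - ℓ * w) +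
      AdjoinRoot.of (realPolyQ R) (2 * a₀ * a₁ - p * a₁ ^ 2 - b₀ ^ 2 + 2 * p * b₀ * b₁ - (p ^ 2 - q) * b₁ ^ 2) *
        AdjoinRoot.root (realPolyQ R) = 0 := by
    rw [map_sub, sub_add_eq_add_sub, sub_eq_zero]
    exact hF.symm
  obtain ⟨hX, hY⟩ := coords_eq_zero_quadratic hR key
  exact rat_no_solution_of_aniso p q ℓ haniso w hw a₀ a₁ b₀ b₁ (by linarith) hY

/-! ### §4 Instance: `E = ℚ(√-(2+√2))` (the CM field in `ℚ(ζ₁₆)`), `R = S² + 4S + 2`, `ℓ = 3` -/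

/-- `S² + 4S + 2` is Eisenstein at `2`, hence irreducible over `ℤ`. [folklore] -/
theorem irreducible_sq_add_four_mul_add_two :
    Irreducible (X ^ 2 + C (4 : ℤ) * X + C 2 : Polynomial ℤ) := by
  have hmonic : (X ^ 2 + C (4 : ℤ) * X + C 2 : Polynomial ℤ).Monic := by monicity!
  have hdeg : (X ^ 2 + C (4 : ℤ) * X + C 2 : Polynomial ℤ).natDegree = 2 := by compute_degree!
  have hprime : (Ideal.span {(2 : ℤ)}).IsPrime :=
    (Ideal.span_singleton_prime (by norm_num)).2 Int.prime_two
  refine Polynomial.IsEisensteinAt.irreducible (𝓟 := Ideal.span {(2 : ℤ)}) ⟨?_, ?_, ?_⟩ hprime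
    hmonic.isPrimitive (by rw [hdeg]; norm_num)
  · rw [hmonic.leadingCoeff, Ideal.mem_span_singleton]; norm_num
  · intro n hn
    rw [hdeg] at hn; rw [Ideal.mem_span_singleton]
    interval_cases n <;> simp [coeff_X, coeff_X_pow]
  · rw [Ideal.span_singleton_pow, Ideal.mem_span_singleton]
    simp [coeff_X_pow]

/-- `T⁴ + 4T² + 2` is Eisenstein at `2`, hence irreducible over `ℤ`. [folklore] -/
theorem irreducible_pow_four_add_four_mul_sq_add_two :
    Irreducible (X ^ 4 + C (4 : ℤ) * X ^ 2 + C 2 : Polynomial ℤ) := by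
  have hmonic : (X ^ 4 + C (4 : ℤ) * X ^ 2 + C 2 : Polynomial ℤ).Monic := by monicity!
  have hdeg : (X ^ 4 + C (4 : ℤ) * X ^ 2 + C 2 : Polynomial ℤ).natDegree = 4 := by compute_degree!
  have hprime : (Ideal.span {(2 : ℤ)}).IsPrime :=
    (Ideal.span_singleton_prime (by norm_num)).2 Int.prime_two
  refine Polynomial.IsEisensteinAt.irreducible (𝓟 := Ideal.span {(2 : ℤ)}) ⟨?_, ?_, ?_⟩ hprime
    hmonic.isPrimitive (by rw [hdeg]; norm_num)
  · rw [hmonic.leadingCoeff, Ideal.mem_span_singleton]; norm_num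
  · intro n hn
    rw [hdeg] at hn; rw [Ideal.mem_span_singleton]
    interval_cases n <;> simp
  · rw [Ideal.span_singleton_pow, Ideal.mem_span_singleton]
    simp

/-- The `Fact` making `F = ℚ[S]/(S² + 4S + 2) = ℚ(√2)` a field. [cite: Deligne1982HodgeCycles, §4 p. 30] -/
theorem fact_irreducible_realPolyQ_sqrtTwo {R : Polynomial ℤ} (hR : R = X ^ 2 + C 4 * X + C 2) :
    Fact (Irreducible (realPolyQ R)) := by
  subst hR
  refine ⟨?_⟩
  have hmonic : (X ^ 2 + C (4 : ℤ) * X + C 2 : Polynomial ℤ).Monic := by monicity!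
  have h := (hmonic.irreducible_iff_irreducible_map_fraction_map (K := ℚ)).1
    irreducible_sq_add_four_mul_add_two
  rw [algebraMap_int_eq] at h
  exact h

/-- The `Fact` making `E = ℚ[T]/(T⁴ + 4T² + 2) = ℚ(√-(2+√2))` a field. [cite: Deligne1982HodgeCycles, §4 p. 30] -/
theorem fact_irreducible_cmPolyQ_sqrtNegTwoPlusSqrtTwo {R : Polynomial ℤ} (hR : R = X ^ 2 + C 4 * X + C 2) :
    Fact (Irreducible (cmPolyQ R)) := by
  subst hR
  refine ⟨?_⟩
  have hmonic : (X ^ 4 + C (4 : ℤ) * X ^ 2 + C 2 : Polynomial ℤ).Monic := by monicity!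
  have h := (hmonic.irreducible_iff_irreducible_map_fraction_map (K := ℚ)).1
    irreducible_pow_four_add_four_mul_sq_add_two
  have hc : (X ^ 2 + C (4 : ℤ) * X + C 2 : Polynomial ℤ).comp (X ^ 2) =
      (X ^ 4 + C (4 : ℤ) * X ^ 2 + C 2 : Polynomial ℤ) := by
    simp only [add_comp, mul_comp, pow_comp, X_comp, C_comp]
    ring
  have e : cmPolyQ (X ^ 2 + C (4 : ℤ) * X + C 2) =
      (X ^ 4 + C (4 : ℤ) * X ^ 2 + C 2 : Polynomial ℤ).map (algebraMap ℤ ℚ) := by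
    rw [algebraMap_int_eq, ← hc]
  rw [e]
  exact h

/-- **Anisotropy mod 3 for `(p, q) = (4, 2)`** (`3` is inert in `ℚ(√2)` and in `ℚ(√-(2+√2))/ℚ(√2)`):
81 cases. [folklore] -/
theorem aniso_three_sqrtNegTwoPlusSqrtTwo :
    ∀ a b c d : ZMod 3,
      a ^ 2 - ((2 : ℤ) : ZMod 3) * b ^ 2 + 2 * ((2 : ℤ) : ZMod 3) * c * d
          - ((4 : ℤ) : ZMod 3) * ((2 : ℤ) : ZMod 3) * d ^ 2 = 0 →
      2 * a * b - ((4 : ℤ) : ZMod 3) * b ^ 2 - c ^ 2 + 2 * ((4 : ℤ) : ZMod 3) * c * d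
          - (((4 : ℤ) : ZMod 3) ^ 2 - ((2 : ℤ) : ZMod 3)) * d ^ 2 = 0 →
        a = 0 ∧ b = 0 ∧ c = 0 ∧ d = 0 := by
  decide

/-- **`[3w] ≠ [1]` in `F^×/Nm_{E/F}(E^×)` for `E = ℚ(√-(2+√2))`, `F = ℚ(√2)`, `3 ∤ w`** (Deligne's
`R = S² + 4S + 2`, `η² = -(2+√2)`): the Weil-type components `(E, 4, [3])`, `[6]`, `[15]`, … of the census
are NON-SPLIT. [cite: Deligne1982HodgeCycles, §4 p. 30 (1) and Cor. 4.2] [cite: Landherr1936HermitianForms] -/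
theorem sqrtNegTwoPlusSqrtTwo_mk_three_mul_ne_splitDiscriminantClassCM {R : Polynomial ℤ}
    (hR : R = X ^ 2 + C 4 * X + C 2) [Fact (Irreducible (realPolyQ R))] (w : ℤ) (hw : ¬ (3 : ℤ) ∣ w)
    (u : (realField R)ˣ) (hu : (u : realField R) = AdjoinRoot.of (realPolyQ R) (3 * w)) :
    (QuotientGroup.mk u : cmNormResidueGroup R) ≠ splitDiscriminantClassCM R 2 := by
  haveI : Fact (Irreducible (cmPolyQ R)) := fact_irreducible_cmPolyQ_sqrtNegTwoPlusSqrtTwo hR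
  haveI : Fact (Nat.Prime 3) := ⟨Nat.prime_three⟩
  exact mk_prime_mul_ne_splitDiscriminantClassCM hR 3 aniso_three_sqrtNegTwoPlusSqrtTwo w hw u
    (by rw [hu]; push_cast; ring_nf)

/-- **`[3] ≠ [1]`** for `E = ℚ(√-(2+√2))`: the row `W8.E.{(√2),(3)}` (least representative `δ = 3`) of the
census is a non-split component. [cite: Deligne1982HodgeCycles, §4 p. 30 (1) and Cor. 4.2] -/
theorem sqrtNegTwoPlusSqrtTwo_mk_three_ne_splitDiscriminantClassCM {R : Polynomial ℤ}
    (hR : R = X ^ 2 + C 4 * X + C 2) [Fact (Irreducible (realPolyQ R))]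
    (u : (realField R)ˣ) (hu : (u : realField R) = 3) :
    (QuotientGroup.mk u : cmNormResidueGroup R) ≠ splitDiscriminantClassCM R 2 :=
  sqrtNegTwoPlusSqrtTwo_mk_three_mul_ne_splitDiscriminantClassCM hR 1 (by norm_num) u (by rw [hu]; simp)

/-- **Unconditional packaging** for `R = S² + 4S + 2` LITERALLY: the class of `3` is not the split
class. [cite: Deligne1982HodgeCycles, §4 p. 30 (1) and Cor. 4.2] -/
theorem sqrtNegTwoPlusSqrtTwo_three_nonsplit :
    haveI := fact_irreducible_realPolyQ_sqrtTwo (R := X ^ 2 + C 4 * X + C 2) rfl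
    ∀ u : (realField (X ^ 2 + C 4 * X + C 2))ˣ, (u : realField (X ^ 2 + C 4 * X + C 2)) = 3 →
      (QuotientGroup.mk u : cmNormResidueGroup (X ^ 2 + C 4 * X + C 2)) ≠
        splitDiscriminantClassCM (X ^ 2 + C 4 * X + C 2) 2 := by
  haveI := fact_irreducible_realPolyQ_sqrtTwo (R := X ^ 2 + C 4 * X + C 2) rfl
  exact fun u hu => sqrtNegTwoPlusSqrtTwo_mk_three_ne_splitDiscriminantClassCM rfl u hu

end Summit.HodgeConjecture.HodgeConjecture.Ring2.WeilCoverageCM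

end
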